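import Literature.Barriers.CriticalPhenomena.GridSAWCountingViaGridHamPath
import Literature.Computability.Complexity.SharpPClosure
import Literature.Computability.MetaComplexity.FregeProofs
import HarnessLib

/-!
# Towards `SAWCOUNT₁ ∈ #P` (and `SAWCOUNT₄ ∈ #P`): the witness relations and the counting
# identities (machine-free part of the membership half of Theorem 7, Liśkiewicz–Ogihara–Toda 2003)

Sibling proof file of `GridSAWCountingSharpPComplete.lean` / `…ViaGridHamPath.lean`
(`Literature/Barriers/CriticalPhenomena/`, D-0021), continuing the decomposition of
`GridSAW.LOT2003_thm7_fixedLength` recorded there. The sub-fact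
`LOT2003_thm7_fixedLength_mem : SAWCOUNT₁ ∈ #P` (membership half of Theorem 7 (1); implicit in
"complete for `#P`", not argued in print) asks, for the tree's `#P`
(`Literature.Computability.Complexity.SharpP`: `f x = #{y ∈ {0,1}^{p |x|} | ⟨x, y⟩ ∈ R}` with `R ∈ P`, Arora–Barak
§17.2, Def. 17.5), for a polynomial-time witness relation counting the walks EXACTLY. This file
supplies everything except the two machines:

* **witness codes** `walkCode ω` (the `listBool` code of the vertex list) padded to the exact
  witness length by `padTo m c = c · 1 · 0^{m-|c|-1}` (invertible: `unpad_padTo`), and the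
  bound `length_walkCode_lt`: a SAW of the instance coded by `w` has fewer than
  `witnessPoly(|w|) = 2|w|² + 4|w| + 3` code bits (its vertices are end points of coded edges,
  at most `2|E| ≤ |w|` of them, each of code length `≤ |w|`; the length of a `listBool` code is
  `Literature.Computability.MetaComplexity.length_encode_listBool` of `MetaComplexity/FregeProofs.lean`);
* **the witness relations** `SAWRel₁`, `SAWRel₄`: `⟨w, y⟩` with `w` the (canonical) code of an
  instance `(E, t, n)` resp. `(E, t)`, `E` a grid subgraph, and `y` the padded code of a SAW of
  `E` from the origin to `t` (of length `n`);
* **the counting identities** `SAWCOUNT₁'_eq_countWitnesses`, `SAWCOUNT₄'_eq_countWitnesses`: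
  on canonical codes the number of witnesses of length `witnessPoly(|w|)` is the number of walks,
  and it is `0` on all other strings — for the restrictions `SAWCOUNT₁'`, `SAWCOUNT₄'` of the
  counting functions to canonical codes (`Set.range encode`);
* **canonicalisation** `canon₁`, `canon₄` (`w ↦ encode (decode w)`):
  `SAWCOUNTᵢ = SAWCOUNTᵢ' ∘ canonᵢ` (`SAWCOUNT₁'_canon₁`), because `SAWCOUNTᵢ` is defined through `decode`, which accepts
  non-canonical numerals (Mathlib's `decodeNat [false] = 2`, `unaryDecodeNat = length`);
* **the conditional memberships** `LOT2003_thm7_fixedLength_mem_of`,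
  `SAWCOUNT₄_mem_SharpP_of`: if `SAWRelᵢ ∈ P` (a verifier) and `canonᵢ ∈ FP` (a transcoder) then
  `SAWCOUNTᵢ ∈ #P`, by the counting identity and the tree's closure of `#P` under polynomial-time
  preprocessing (`Literature.Computability.Complexity.comp_mem_SharpP`, Valiant 1979 §2).

What remains for `LOT2003_thm7_fixedLength_mem` are the two machine facts `SAWRel₁ ∈ P` and
`canon₁ ∈ FP` (structured stack programs, `StackPrograms.lean`; the transcoder pattern of
`NegCNFTranscoder.lean`), stated here as the hypotheses of the conditional theorems, not as
named facts.

Status (barrier audit 2026-08-15): both machine facts have since been PROVED in the sibling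
`GridSAWCountingVerifier.lean` (`SAWRel₁_mem_P`, `canon₁_mem_FP`, `SAWRel₄_mem_P`,
`canon₄_mem_FP`, assembled from the tree's `FP` bricks), which discharges
`LOT2003_thm7_fixedLength_mem_holds : SAWCOUNT₁ ∈ #P` and
`LOT2003_thm7_anyLength_mem_holds : SAWCOUNT₄ ∈ #P` with axioms `propext`, `Classical.choice`,
`Quot.sound` only; the membership halves of Theorem 7 (1) and (4) are therefore theorems of the
tree over its `TM2`-based classes `P`/`FP` (`Literature.Computability.Complexity.Classes.P`,
`Literature.Computability.Complexity.FP`), not named facts.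

## References

* M. Liśkiewicz, M. Ogihara, S. Toda, *The complexity of counting self-avoiding walks in
  subgraphs of two-dimensional grids and hypercubes*, TCS 304 (2003), Theorem 7.
* S. Arora, B. Barak, *Computational Complexity: A Modern Approach*, CUP 2009, §17.2,
  Def. 17.5 (`#P` by witness counting, witnesses of exact length `p(|x|)`; the same page gives the
  equivalent accepting-path form used by Liśkiewicz–Ogihara–Toda, §2.1), §0.1 (codes). (Earlier
  revisions of this file cited the definition as "Def. 17.2", a slip for the section number; in the
  printed 2009 edition `#P` is Definition 17.5 and `#P`-completeness Definition 17.8.)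
* L. G. Valiant, *The complexity of computing the permanent*, TCS 8 (1979), §2.
-/

noncomputable section

namespace Literature.Barriers.CriticalPhenomena.GridSAW

open _root_.Computability Literature.Computability.Complexity Literature.Computability.MetaComplexity Literature.Computability.Complexity.Classes Polynomial

/-! ### Padding to exact length -/

/-- `padTo m c = c · 1 · 0^{m - |c| - 1}`: the code `c` followed by a marker `1` and zeros up to
length `m` (when `|c| < m`). [cite: AroraBarak2009, Def. 17.5 (witnesses of exact length)] -/
def padTo (m : ℕ) (c : List Bool) : List Bool :=
  c ++ true :: List.replicate (m - c.length - 1) false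

/-- Inverse of `padTo m`: strip the trailing zeros and the marker. [folklore] -/
def unpad (y : List Bool) : List Bool :=
  ((y.reverse.dropWhile fun b => !b).tail).reverse

/-- `|padTo m c| = m` when `|c| < m`. [folklore] -/
theorem length_padTo {m : ℕ} {c : List Bool} (h : c.length < m) : (padTo m c).length = m := by
  simp only [padTo, List.length_append, List.length_cons, List.length_replicate]
  omega

/-- `unpad (padTo m c) = c`. [folklore] -/
@[simp] theorem unpad_padTo (m : ℕ) (c : List Bool) : unpad (padTo m c) = c := by
  have h : ∀ (k : ℕ) (r : List Bool),
      (List.replicate k false ++ true :: r).dropWhile (fun b => !b) = true :: r := by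
    intro k r
    induction k with
    | zero => simp
    | succ k ih => simp [List.replicate_succ, ih]
  simp [unpad, padTo, h]

/-- `padTo m` is injective. [folklore] -/
theorem padTo_injective (m : ℕ) : Function.Injective (padTo m) := fun c c' h => by
  simpa using congr_arg unpad h

/-! ### Witness codes of walks and their length -/

/-- The code of a walk: the `listBool` code of its vertex list (grid points in sign–magnitude
binary, `encodingGridPoint`). [cite: AroraBarak2009, §0.1] -/
def walkCode (ω : List GridPoint) : List Bool :=
  encodingGridPoint.listBool.encode ω

/-- `walkCode` is injective. [folklore] -/
theorem walkCode_injective : Function.Injective walkCode :=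
  encodingGridPoint.listBool.encode_injective

/-- The witness-length polynomial `2X² + 4X + 3`. [cite: AroraBarak2009, Def. 17.5] -/
def witnessPoly : Polynomial ℕ :=
  2 * X ^ 2 + 4 * X + 3

/-- `witnessPoly(n) = 2n² + 4n + 3`. [folklore] -/
@[simp] theorem witnessPoly_eval (n : ℕ) : witnessPoly.eval n = 2 * n ^ 2 + 4 * n + 3 := by
  simp [witnessPoly]

/-- A component's code is no longer than the list's code. [folklore] -/
theorem length_encode_le_length_encode_listBool {α : Type} (e : Encoding α Bool) {l : List α}
    {a : α} (ha : a ∈ l) : (e.encode a).length ≤ (e.listBool.encode l).length := by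
  rw [length_encode_listBool]
  have h : 2 * (e.encode a).length + 2 ≤ (l.map fun a => 2 * (e.encode a).length + 2).sum :=
    List.single_le_sum (fun _ _ => Nat.zero_le _) _ (List.mem_map.mpr ⟨a, ha, rfl⟩)
  omega

/-- Twice the number of components is at most the length of the list's code. [folklore] -/
theorem two_mul_length_le_length_encode_listBool {α : Type} (e : Encoding α Bool) (l : List α) :
    2 * l.length ≤ (e.listBool.encode l).length := by
  rw [length_encode_listBool]; omega

/-- The code of a vertex of `E` is no longer than the code of `E`. [folklore] -/
theorem length_encode_le_of_mem_vertexSet {E : EdgeList} {q : GridPoint} (hq : q ∈ vertexSet E) :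
    (encodingGridPoint.encode q).length ≤ (encodingEdgeList.encode E).length := by
  simp only [vertexSet, List.mem_toFinset, List.mem_append, List.mem_map] at hq
  obtain ⟨e, he, rfl⟩ | ⟨e, he, rfl⟩ := hq
  · refine le_trans ?_ (length_encode_le_length_encode_listBool _ he)
    change _ ≤ (boolPair (encodingGridPoint.encode e.1) (encodingGridPoint.encode e.2)).length
    rw [length_boolPair]; omega
  · refine le_trans ?_ (length_encode_le_length_encode_listBool _ he)
    change _ ≤ (boolPair (encodingGridPoint.encode e.1) (encodingGridPoint.encode e.2)).length
    rw [length_boolPair]; omega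

/-- The vertex set of `E` has at most `2|E|` elements. [folklore] -/
theorem card_vertexSet_le (E : EdgeList) : (vertexSet E).card ≤ 2 * E.length := by
  refine (List.toFinset_card_le _).trans ?_
  simp [two_mul]

/-- A SAW of `E` has at most `|vertexSet E|` vertices. [folklore] -/
theorem IsSAWIn.length_le {E : EdgeList} {ω : List GridPoint} (h : IsSAWIn E ω) :
    ω.length ≤ (vertexSet E).card := by
  rw [← List.toFinset_card_of_nodup h.2.1]
  exact Finset.card_le_card fun p hp => h.2.2.1 p (List.mem_toFinset.mp hp)

/-- **Length bound for witness codes**: a SAW of `E` has a code of length at most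
`2k² + 4k + 2` whenever the code of `E` has length `≤ k`. [cite: AroraBarak2009, Def. 17.5] -/
theorem length_walkCode_le {E : EdgeList} {ω : List GridPoint} (h : IsSAWIn E ω) {k : ℕ}
    (hk : (encodingEdgeList.encode E).length ≤ k) :
    (walkCode ω).length ≤ 2 * k ^ 2 + 4 * k + 2 := by
  have hlen : ω.length ≤ k :=
    (h.length_le.trans (card_vertexSet_le E)).trans
      ((two_mul_length_le_length_encode_listBool _ E).trans hk)
  have hsum : (ω.map fun a => 2 * (encodingGridPoint.encode a).length + 2).sum ≤
      ω.length * (2 * k + 2) := by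
    have hb : ∀ a ∈ ω, 2 * (encodingGridPoint.encode a).length + 2 ≤ 2 * k + 2 := fun a ha =>
      by have := (length_encode_le_of_mem_vertexSet (h.2.2.1 a ha)).trans hk; omega
    clear hlen h hk
    induction ω with
    | nil => simp
    | cons a l ih =>
      simp only [List.map_cons, List.sum_cons, List.length_cons]
      have h1 := hb a (by simp)
      have h2 := ih fun b hb' => hb b (by simp [hb'])
      nlinarith
  rw [walkCode, length_encode_listBool]
  nlinarith [hsum, hlen, Nat.mul_le_mul hlen (le_refl (2 * k + 2))]

/-! ### Counting witnesses of a coded family (generic) -/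

/-- `countWitnesses R m x` is the number of strings `y` of length `m` with `⟨x, y⟩ ∈ R`.
[cite: AroraBarak2009, Def. 17.5] -/
theorem countWitnesses_eq_ncard (R : Language Bool) (m : ℕ) (x : List Bool) :
    countWitnesses R m x = {y : List Bool | y.length = m ∧ boolPair x y ∈ R}.ncard := by
  classical
  unfold countWitnesses
  rw [← Set.ncard_coe_finset, ← Set.ncard_image_of_injective _ List.Vector.toList_injective]
  congr 1
  ext y
  simp only [Finset.coe_filter, Finset.mem_univ, true_and, Set.mem_image, Set.mem_setOf_eq]
  constructor
  · rintro ⟨v, hv, rfl⟩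
    exact ⟨v.toList_length, by convert hv⟩
  · rintro ⟨hy, hR⟩
    exact ⟨⟨y, hy⟩, hR, rfl⟩

/-- **Generic counting identity.** Let instances `i : ι` be coded injectively by `enc`, let
`S i` be the walks to be counted at `i`, all with codes shorter than `p(|enc i|)`, and let `R`
consist exactly of the pairs `⟨enc i, padTo (p |enc i|) (walkCode ω)⟩`, `ω ∈ S i`. Then the
number of witnesses of length `p(|enc i|)` for `enc i` is `|S i|`.
[cite: AroraBarak2009, Def. 17.5 (padding witnesses to exact length)] -/
theorem countWitnesses_eq_ncard_of_coding {ι : Type} (enc : ι → List Bool)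
    (henc : Function.Injective enc) (S : ι → Set (List GridPoint)) (p : Polynomial ℕ)
    (hlen : ∀ i, ∀ ω ∈ S i, (walkCode ω).length < p.eval (enc i).length) (R : Language Bool)
    (hR : ∀ z, z ∈ R ↔ ∃ i, ∃ ω ∈ S i,
      z = boolPair (enc i) (padTo (p.eval (enc i).length) (walkCode ω)))
    (i : ι) : countWitnesses R (p.eval (enc i).length) (enc i) = (S i).ncard := by
  rw [countWitnesses_eq_ncard]
  have hset : {y : List Bool | y.length = p.eval (enc i).length ∧ boolPair (enc i) y ∈ R} =
      (fun ω => padTo (p.eval (enc i).length) (walkCode ω)) '' S i := by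
    ext y
    simp only [Set.mem_setOf_eq, Set.mem_image, hR]
    constructor
    · rintro ⟨-, j, ω, hω, hz⟩
      have h := congr_arg boolUnpair hz
      simp only [boolUnpair_boolPair, Prod.mk.injEq] at h
      obtain ⟨h1, rfl⟩ := h
      obtain rfl := henc h1
      exact ⟨ω, hω, rfl⟩
    · rintro ⟨ω, hω, rfl⟩
      exact ⟨length_padTo (hlen i ω hω), i, ω, hω, rfl⟩
  rw [hset]
  exact Set.ncard_image_of_injective _ fun ω ω' h =>
    walkCode_injective (padTo_injective _ h)

/-- … and a string outside the range of the coding has no witnesses at all.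
[cite: AroraBarak2009, Def. 17.5] -/
theorem countWitnesses_eq_zero_of_not_mem_range {ι : Type} (enc : ι → List Bool)
    (S : ι → Set (List GridPoint)) (p : Polynomial ℕ) (R : Language Bool)
    (hR : ∀ z, z ∈ R ↔ ∃ i, ∃ ω ∈ S i,
      z = boolPair (enc i) (padTo (p.eval (enc i).length) (walkCode ω)))
    {w : List Bool} (hw : w ∉ Set.range enc) (m : ℕ) : countWitnesses R m w = 0 := by
  rw [countWitnesses_eq_ncard]
  convert Set.ncard_empty (List Bool)
  ext y
  simp only [Set.mem_setOf_eq, Set.mem_empty_iff_false, iff_false, not_and, hR]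
  rintro - ⟨j, ω, -, hz⟩
  have h := congr_arg boolUnpair hz
  simp only [boolUnpair_boolPair, Prod.mk.injEq] at h
  exact hw ⟨j, h.1.symm⟩

/-! ### Version (1): fixed length -/

/-- The walks counted by version (1) at the instance `(E, t, n)`: SAWs of the grid subgraph `E`
from the origin to `t` with `n + 1` vertices (none unless `E` is a grid subgraph).
[cite: LiskiewiczOgiharaToda2003, §4 (version (1))] -/
def walks₁ (i : EdgeList × GridPoint × ℕ) : Set (List GridPoint) :=
  {ω | IsGridSubgraph i.1 ∧ ω ∈ sawsFromOriginTo i.1 i.2.1 ∧ ω.length = i.2.2 + 1}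

/-- `|walks₁ (E, t, n)|` is the value of `SAWCOUNT₁` at the code of `(E, t, n)`.
[cite: LiskiewiczOgiharaToda2003, §4 (version (1))] -/
theorem ncard_walks₁ (i : EdgeList × GridPoint × ℕ) :
    (walks₁ i).ncard = SAWCOUNT₁ (encodingFixedLengthInstance.encode i) := by
  obtain ⟨E, t, n⟩ := i
  by_cases hE : IsGridSubgraph E
  · rw [SAWCOUNT₁_encode E t n hE, sawCountFixedLength]
    congr 1
    ext ω
    simp [walks₁, hE]
  · have h0 : SAWCOUNT₁ (encodingFixedLengthInstance.encode (E, t, n)) = 0 := by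
      simp [SAWCOUNT₁, encodingFixedLengthInstance.decode_encode, hE]
    rw [h0]
    convert Set.ncard_empty (List GridPoint)
    ext ω
    simp [walks₁, hE]

/-- **The witness relation of version (1)**: pairs `⟨w, y⟩` with `w` the code of an instance
`(E, t, n)`, `E` a grid subgraph, and `y` the code of a SAW of `E` from the origin to `t` with
`n + 1` vertices, padded to length `witnessPoly(|w|)`.
[cite: AroraBarak2009, Def. 17.5] [cite: LiskiewiczOgiharaToda2003, Theorem 7 (version (1))] -/
def SAWRel₁ : Language Bool :=
  {z | ∃ i : EdgeList × GridPoint × ℕ, ∃ ω ∈ walks₁ i,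
    z = boolPair (encodingFixedLengthInstance.encode i)
      (padTo (witnessPoly.eval (encodingFixedLengthInstance.encode i).length) (walkCode ω))}

/-- Codes of the walks of an instance are shorter than the witness length.
[cite: AroraBarak2009, Def. 17.5] -/
theorem length_walkCode_lt_of_mem_walks₁ (i : EdgeList × GridPoint × ℕ) {ω : List GridPoint}
    (hω : ω ∈ walks₁ i) :
    (walkCode ω).length < witnessPoly.eval (encodingFixedLengthInstance.encode i).length := by
  obtain ⟨E, t, n⟩ := i
  have hk : (encodingEdgeList.encode E).length ≤
      (encodingFixedLengthInstance.encode (E, t, n)).length := by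
    change _ ≤ (boolPair (encodingEdgeList.encode E) _).length
    rw [length_boolPair]; omega
  have h := length_walkCode_le hω.2.1.1 hk
  rw [witnessPoly_eval]; omega

open Classical in
/-- `SAWCOUNT₁` restricted to canonical codes (the range of `encode`), `0` elsewhere.
[cite: LiskiewiczOgiharaToda2003, §4 (version (1))] -/
def SAWCOUNT₁' (w : List Bool) : ℕ :=
  if w ∈ Set.range encodingFixedLengthInstance.encode then SAWCOUNT₁ w else 0

/-- **Counting identity, version (1)**: the number of `SAWRel₁`-witnesses of length
`witnessPoly(|w|)` is `SAWCOUNT₁' w` for every string `w`.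
[cite: AroraBarak2009, Def. 17.5] [cite: LiskiewiczOgiharaToda2003, Theorem 7 (version (1), membership)] -/
theorem SAWCOUNT₁'_eq_countWitnesses (w : List Bool) :
    SAWCOUNT₁' w = countWitnesses SAWRel₁ (witnessPoly.eval w.length) w := by
  have hR : ∀ z, z ∈ SAWRel₁ ↔ ∃ i, ∃ ω ∈ walks₁ i,
      z = boolPair (encodingFixedLengthInstance.encode i)
        (padTo (witnessPoly.eval (encodingFixedLengthInstance.encode i).length) (walkCode ω)) :=
    fun _ => Iff.rfl
  by_cases hw : w ∈ Set.range encodingFixedLengthInstance.encode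
  · obtain ⟨i, rfl⟩ := hw
    rw [countWitnesses_eq_ncard_of_coding _ encodingFixedLengthInstance.encode_injective walks₁
      witnessPoly length_walkCode_lt_of_mem_walks₁ SAWRel₁ hR i, ncard_walks₁, SAWCOUNT₁']
    simp
  · rw [countWitnesses_eq_zero_of_not_mem_range _ walks₁ witnessPoly SAWRel₁ hR hw, SAWCOUNT₁']
    simp [hw]

/-- **Canonicalisation of instance codes, version (1)**: re-encode the decoded instance (the
identity on strings that do not decode). [cite: AroraBarak2009, §0.1] -/
def canon₁ (w : List Bool) : List Bool :=
  match encodingFixedLengthInstance.decode w with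
  | some i => encodingFixedLengthInstance.encode i
  | none => w

/-- `SAWCOUNT₁ = SAWCOUNT₁' ∘ canon₁`: the counting function only depends on the decoded
instance. [cite: LiskiewiczOgiharaToda2003, §4 (version (1))] -/
theorem SAWCOUNT₁'_canon₁ (w : List Bool) : SAWCOUNT₁' (canon₁ w) = SAWCOUNT₁ w := by
  unfold canon₁
  cases hd : encodingFixedLengthInstance.decode w with
  | some i =>
    have h1 : SAWCOUNT₁' (encodingFixedLengthInstance.encode i) =
        SAWCOUNT₁ (encodingFixedLengthInstance.encode i) := by
      simp [SAWCOUNT₁']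
    rw [h1]
    simp only [SAWCOUNT₁, encodingFixedLengthInstance.decode_encode, hd]
  | none =>
    have hw : w ∉ Set.range encodingFixedLengthInstance.encode := by
      rintro ⟨i, rfl⟩
      rw [encodingFixedLengthInstance.decode_encode] at hd
      exact Option.some_ne_none _ hd
    simp only [SAWCOUNT₁', hw, if_false, SAWCOUNT₁, hd]

/-- **Membership of version (1), conditional on the two machines**: if the witness relation
`SAWRel₁` is in `P` (a polynomial-time verifier of padded walk codes against canonical
instance codes) and the canonicalisation `canon₁` is in `FP` (a transcoder), then
`SAWCOUNT₁ ∈ #P` — the sub-fact `LOT2003_thm7_fixedLength_mem` of the decomposition of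
Theorem 7 (1). [cite: LiskiewiczOgiharaToda2003, Theorem 7 (version (1), membership in #P)]
[cite: AroraBarak2009, Def. 17.5] -/
theorem LOT2003_thm7_fixedLength_mem_of (hR : SAWRel₁ ∈ P) (hc : canon₁ ∈ FP) :
    LOT2003_thm7_fixedLength_mem := by
  have h' : SAWCOUNT₁' ∈ SharpP := ⟨SAWRel₁, hR, witnessPoly, SAWCOUNT₁'_eq_countWitnesses⟩
  have heq : SAWCOUNT₁' ∘ canon₁ = SAWCOUNT₁ := funext SAWCOUNT₁'_canon₁
  have h := comp_mem_SharpP h' hc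
  rw [heq] at h
  exact h

/-! ### Version (4): any length -/

/-- The walks counted by version (4) at the instance `(E, t)`: SAWs of the grid subgraph `E`
from the origin to `t` (none unless `E` is a grid subgraph).
[cite: LiskiewiczOgiharaToda2003, §4 (version (4))] -/
def walks₄ (i : EdgeList × GridPoint) : Set (List GridPoint) :=
  {ω | IsGridSubgraph i.1 ∧ ω ∈ sawsFromOriginTo i.1 i.2}

/-- `|walks₄ (E, t)|` is the value of `SAWCOUNT₄` at the code of `(E, t)`.
[cite: LiskiewiczOgiharaToda2003, §4 (version (4))] -/
theorem ncard_walks₄ (i : EdgeList × GridPoint) :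
    (walks₄ i).ncard = SAWCOUNT₄ (encodingAnyLengthInstance.encode i) := by
  obtain ⟨E, t⟩ := i
  by_cases hE : IsGridSubgraph E
  · rw [SAWCOUNT₄_encode E t hE, sawCountAnyLength]
    congr 1
    ext ω
    simp [walks₄, hE]
  · have h0 : SAWCOUNT₄ (encodingAnyLengthInstance.encode (E, t)) = 0 := by
      simp [SAWCOUNT₄, encodingAnyLengthInstance.decode_encode, hE]
    rw [h0]
    convert Set.ncard_empty (List GridPoint)
    ext ω
    simp [walks₄, hE]

/-- **The witness relation of version (4)**: pairs `⟨w, y⟩` with `w` the code of `(E, t)`, `E` a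
grid subgraph, and `y` the padded code of a SAW of `E` from the origin to `t`.
[cite: AroraBarak2009, Def. 17.5] [cite: LiskiewiczOgiharaToda2003, Theorem 7 (version (4))] -/
def SAWRel₄ : Language Bool :=
  {z | ∃ i : EdgeList × GridPoint, ∃ ω ∈ walks₄ i,
    z = boolPair (encodingAnyLengthInstance.encode i)
      (padTo (witnessPoly.eval (encodingAnyLengthInstance.encode i).length) (walkCode ω))}

/-- Codes of the walks of an instance are shorter than the witness length (version (4)).
[cite: AroraBarak2009, Def. 17.5] -/
theorem length_walkCode_lt_of_mem_walks₄ (i : EdgeList × GridPoint) {ω : List GridPoint}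
    (hω : ω ∈ walks₄ i) :
    (walkCode ω).length < witnessPoly.eval (encodingAnyLengthInstance.encode i).length := by
  obtain ⟨E, t⟩ := i
  have hk : (encodingEdgeList.encode E).length ≤
      (encodingAnyLengthInstance.encode (E, t)).length := by
    change _ ≤ (boolPair (encodingEdgeList.encode E) _).length
    rw [length_boolPair]; omega
  have h := length_walkCode_le hω.2.1 hk
  rw [witnessPoly_eval]; omega

open Classical in
/-- `SAWCOUNT₄` restricted to canonical codes, `0` elsewhere.
[cite: LiskiewiczOgiharaToda2003, §4 (version (4))] -/
def SAWCOUNT₄' (w : List Bool) : ℕ :=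
  if w ∈ Set.range encodingAnyLengthInstance.encode then SAWCOUNT₄ w else 0

/-- **Counting identity, version (4)**: the number of `SAWRel₄`-witnesses of length
`witnessPoly(|w|)` is `SAWCOUNT₄' w`.
[cite: AroraBarak2009, Def. 17.5] [cite: LiskiewiczOgiharaToda2003, Theorem 7 (version (4))] -/
theorem SAWCOUNT₄'_eq_countWitnesses (w : List Bool) :
    SAWCOUNT₄' w = countWitnesses SAWRel₄ (witnessPoly.eval w.length) w := by
  have hR : ∀ z, z ∈ SAWRel₄ ↔ ∃ i, ∃ ω ∈ walks₄ i,
      z = boolPair (encodingAnyLengthInstance.encode i)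
        (padTo (witnessPoly.eval (encodingAnyLengthInstance.encode i).length) (walkCode ω)) :=
    fun _ => Iff.rfl
  by_cases hw : w ∈ Set.range encodingAnyLengthInstance.encode
  · obtain ⟨i, rfl⟩ := hw
    rw [countWitnesses_eq_ncard_of_coding _ encodingAnyLengthInstance.encode_injective walks₄
      witnessPoly length_walkCode_lt_of_mem_walks₄ SAWRel₄ hR i, ncard_walks₄, SAWCOUNT₄']
    simp
  · rw [countWitnesses_eq_zero_of_not_mem_range _ walks₄ witnessPoly SAWRel₄ hR hw, SAWCOUNT₄']
    simp [hw]

/-- **Canonicalisation of instance codes, version (4)**. [cite: AroraBarak2009, §0.1] -/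
def canon₄ (w : List Bool) : List Bool :=
  match encodingAnyLengthInstance.decode w with
  | some i => encodingAnyLengthInstance.encode i
  | none => w

/-- `SAWCOUNT₄ = SAWCOUNT₄' ∘ canon₄`. [cite: LiskiewiczOgiharaToda2003, §4 (version (4))] -/
theorem SAWCOUNT₄'_canon₄ (w : List Bool) : SAWCOUNT₄' (canon₄ w) = SAWCOUNT₄ w := by
  unfold canon₄
  cases hd : encodingAnyLengthInstance.decode w with
  | some i =>
    have h1 : SAWCOUNT₄' (encodingAnyLengthInstance.encode i) =
        SAWCOUNT₄ (encodingAnyLengthInstance.encode i) := by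
      simp [SAWCOUNT₄']
    rw [h1]
    simp only [SAWCOUNT₄, encodingAnyLengthInstance.decode_encode, hd]
  | none =>
    have hw : w ∉ Set.range encodingAnyLengthInstance.encode := by
      rintro ⟨i, rfl⟩
      rw [encodingAnyLengthInstance.decode_encode] at hd
      exact Option.some_ne_none _ hd
    simp only [SAWCOUNT₄', hw, if_false, SAWCOUNT₄, hd]

/-- **Membership of version (4), conditional on the two machines**: `SAWRel₄ ∈ P` and
`canon₄ ∈ FP` give `SAWCOUNT₄ ∈ #P` (the membership half of Theorem 7 (4), i.e. of
`LOT2003_thm7_anyLength`).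
[cite: LiskiewiczOgiharaToda2003, Theorem 7 (version (4), membership in #P)]
[cite: AroraBarak2009, Def. 17.5] -/
theorem SAWCOUNT₄_mem_SharpP_of (hR : SAWRel₄ ∈ P) (hc : canon₄ ∈ FP) : SAWCOUNT₄ ∈ SharpP := by
  have h' : SAWCOUNT₄' ∈ SharpP := ⟨SAWRel₄, hR, witnessPoly, SAWCOUNT₄'_eq_countWitnesses⟩
  have heq : SAWCOUNT₄' ∘ canon₄ = SAWCOUNT₄ := funext SAWCOUNT₄'_canon₄
  have h := comp_mem_SharpP h' hc
  rw [heq] at h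
  exact h

/-! ### Sanity checks -/

/-- `padTo` in action: `padTo 5 [1, 0] = [1, 0, 1, 0, 0]`. [folklore] -/
example : padTo 5 [true, false] = [true, false, true, false, false] := by decide

/-- `unpad` in action. [folklore] -/
example : unpad [true, false, true, false, false] = [true, false] := by decide

/-- The two-vertex walk on the one-edge graph is a version-(1) witness walk of the instance
`([(0,0)–(0,1)], (0,1), 1)` (non-vacuity of `walks₁` and `SAWRel₁`). [folklore] -/
theorem singleEdge_mem_walks₁ :
    [((0 : ℤ), (0 : ℤ)), (0, 1)] ∈ walks₁ ([((0, 0), (0, 1))], (0, 1), 1) :=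
  ⟨isGridSubgraph_singleEdge, singleEdge_mem_sawsFromOriginTo, rfl⟩

/-- Hence `SAWRel₁` is nonempty. [folklore] -/
theorem SAWRel₁_nonempty : SAWRel₁.Nonempty :=
  ⟨_, _, _, singleEdge_mem_walks₁, rfl⟩

end Literature.Barriers.CriticalPhenomena.GridSAW
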